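import Literature.Geometry.Riemannian.IsotropicCurvature
import Literature.Geometry.Riemannian.ChenZhuConformalPIC
import Literature.Geometry.Riemannian.OrthonormalFrameBounds
import Literature.Geometry.Riemannian.RiemannianDistance
import Literature.Geometry.Lorentzian.Volume
import Literature.Geometry.Lorentzian.VolumeProofs
import Literature.Geometry.Lorentzian.EnergyCurrents
import Literature.Geometry.Lorentzian.LeviCivitaProofs
import Literature.Geometry.Lorentzian.CurvatureRegularity
import Literature.Geometry.Lorentzian.ChartLaplacian
import Literature.Geometry.Kaehler.OrthonormalFrame
import Mathlib.Topology.Order.Compact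
import Mathlib.MeasureTheory.Function.LocallyIntegrable
import HarnessLib

/-!
# Neumann positivity of the isotropic Yamabe form; the minimal isotropic curvature is continuous

For a pseudo-Riemannian (in applications: Riemannian) metric `g` on the tangent bundle of a
manifold `M` (`Literature.Geometry.Lorentzian.PseudoRiemannianMetric`) we define

* `NeumannIsotropicFormPos g hg S` — **Neumann positivity of the isotropic Yamabe form on a set
  `S ⊆ M`**: there are `c > 0` and a continuous lower bound `μ` of the isotropic curvatures of `g`
  (`μ x ≤ iso_x(e)` for every `g_x`-orthonormal `4`-frame `e`, `iso` the Micallef–Moore expression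
  `K₁₃ + K₁₄ + K₂₃ + K₂₄ - 2R₁₂₃₄` of `IsotropicCurvature.lean`) such that for every `u ∈ C¹(M)`
  `c ∫_S u² dV_g ≤ ∫_S (6 |∇u|²_g + 3 μ u²) dV_g`,
  `dV_g` the Riemannian measure (`riemannianMeasure`, `Volume.lean`) and `|∇u|²_g = g⁻¹(du, du)`
  (`gradSq`, `EnergyCurrents.lean`). For `S = M` this is positive definiteness on `C¹(M)` of
  Chen–Zhu's functional `∫ (R_g - f(W_g)) u² + (4(n-1)/(n-2)) |∇u|² dV_g` in dimension `n = 4`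
  with `f(W) = 6 max(λ_max W⁺, λ_max W⁻)` (Chen–Zhu 2014, (2.8) and §3), i.e. of the quadratic
  form of the conformally covariant operator `-6Δ_g + σ_g`, `σ_g = R_g - 6 max(λ_max W⁺, λ_max W⁻)`
  being three times the minimal isotropic curvature (Hamilton 1997, §1.2; the tree's
  `Literature.Geometry.Riemannian.minIsotropicCurvature`, `ChenZhuConformalPIC.lean`); on a subset
  `S` (no boundary condition imposed on `u`) it is positivity of the bottom of the *Neumann*
  spectrum of that operator on `S`, the quantity that Dirichlet–Neumann bracketing adds over the
  pieces of a decomposition of `M` (Reed–Simon IV, §XIII.15). This packages the clause inlined by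
  the items of route `SmoothPoincare4/IsotropicCorkBracketing` (there `S` = a cork / its
  complement; `neumannIsotropicFormPos_univ_iff` is the whole-manifold clause of its target).
* `minIsotropicCurvatureWith g cov x` — the infimum over the `g_x`-orthonormal `4`-frames of the
  isotropic curvature of a general connection `cov` on `TM` (the connection a parameter, as in
  `HasPositiveIsotropicCurvatureWith` of `IsotropicCurvature.lean`); the tree's
  `minIsotropicCurvature g x` (4-manifolds, Levi-Civita connection; `ChenZhuConformalPIC.lean`) is
  `minIsotropicCurvatureWith g g.leviCivita x`
  (`minIsotropicCurvature_eq_minIsotropicCurvatureWith`, `rfl`).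

## Main results (all proved)

* `minIsotropicCurvature_le`, `le_minIsotropicCurvature`,
  `exists_isotropicCurvature_eq_minIsotropicCurvature`, `minIsotropicCurvature_pos` — on a
  Riemannian 4-manifold the minimal isotropic curvature is a lower bound of the isotropic
  curvatures, is attained, and is positive under PIC (general versions `…With`): the orthonormal
  `4`-frames at a point are parametrised, in an orthonormal basis, by the compact set `stiefelSet`
  of `4 × dim M` coefficient arrays with orthonormal rows, on which the isotropic curvature is the
  polynomial `isotropicCurvatureCoeff`.
* `continuous_minIsotropicCurvature` (and `continuous_minIsotropicCurvatureWith`) — **the minimal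
  isotropic curvature of a `C^∞` Riemannian metric is continuous**: in a smooth local orthonormal
  frame field (`Literature.Geometry.Kaehler.orthoFrame`, Gram–Schmidt; Warner GTM 94, 4.10) it is
  the minimum over the fixed compact set `stiefelSet` of a polynomial whose coefficients, the
  curvature components in the frame field, are continuous (`contMDiffOn_curvature_apply`, O'Neill
  1983, Lemma 3.35), and such a minimum is continuous (`IsCompact.continuous_sInf`).
* `neumannIsotropicFormPos_iff_minIsotropicCurvature` — on a closed 4-manifold the witness `μ`
  may be taken to be the minimal isotropic curvature: `NeumannIsotropicFormPos g hg S ↔ ∃ c > 0,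
  ∀ u ∈ C¹(M), c ∫_S u² ≤ ∫_S (6|∇u|² + 3 · minIsotropicCurvature g · u²)` (the form in which the
  hypothesis of `chenZhu2014_conformal_pic_four` is written); `neumannIsotropicFormPos_empty`.

## Design

* `NeumannIsotropicFormPos` is stated for any model `I` and regularity `n` (it only needs
  `g.leviCivita`, `gradSq`, `riemannianMeasure`), with the Levi-Civita connection under the
  standing instance `[g.HasLeviCivita]` exactly as in the route items (every `C¹` metric has it,
  `PseudoRiemannianMetric.hasLeviCivita`); the coefficients `6`, `3` are those of dimension `4`,
  where alone the definition is meaningful. The lemmas replacing `μ` by the minimal isotropic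
  curvature are stated on 4-manifolds modelled on `EuclideanSpace ℝ (Fin 4)`, the setting of
  `minIsotropicCurvature` and of the route.
* `minIsotropicCurvatureWith` is an `iInf` over a subtype; without orthonormal `4`-frames
  (dimension `< 4`) it is the junk value `sInf ∅ = 0`, and for an indefinite metric the frame set
  may be non-compact; all lemmas assume `g.IsRiemannian`.
* Mathlib has neither sectional/isotropic curvature nor Schrödinger-form positivity on manifolds;
  orthonormal frame fields are the tree's (`Literature/Geometry/Kaehler/OrthonormalFrame.lean`).

## References

* B.-L. Chen, X.-P. Zhu, *A conformally invariant classification theorem in four dimensions*,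
  Comm. Anal. Geom. 22 (2014) 811–831, arXiv:1206.5051, §2 (2.8), §3. [ChenZhu2014]
* M. Micallef, J. D. Moore, Ann. of Math. 127 (1988) 199–227, §1. [MicallefMoore1988]
* R. S. Hamilton, *Four-manifolds with positive isotropic curvature*, Comm. Anal. Geom. 5 (1997),
  §1.2. [Hamilton1997]
* B. O'Neill, *Semi-Riemannian geometry* (1983), Ch. 3, Lemma 3.35. [ONeill1983]
* M. Reed, B. Simon, *Methods of Modern Mathematical Physics IV* (1978), §XIII.15
  (Dirichlet–Neumann bracketing). [ReedSimonIV1978]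
-/

noncomputable section

open Bundle Set Function MeasureTheory Module
open scoped Manifold ContDiff Topology BigOperators InnerProductSpace

namespace Literature.Geometry.Riemannian

open Lorentzian Lorentzian.PseudoRiemannianMetric

variable {E : Type*} [NormedAddCommGroup E] [NormedSpace ℝ E] {H : Type*} [TopologicalSpace H]
  {I : ModelWithCorners ℝ E H} {M : Type*} [TopologicalSpace M] [ChartedSpace H M]
  [IsManifold I ∞ M] {n : ℕ∞ω}

/-! ### Coefficient arrays of orthonormal `4`-frames -/

section Coefficients

variable {κ : Type*} [Fintype κ]

variable (κ) in
/-- The coefficient arrays `A : Fin 4 → κ → ℝ` with orthonormal rows, `Σ_i A a i A b i = δ_ab`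
(the Stiefel manifold `V₄(ℝ^κ)` as a set): in a `g_x`-orthonormal basis `s` of `T_x M` these are
exactly the coefficients of the `g_x`-orthonormal `4`-frames `e_a = Σ_i A a i • s i`
(`isOrthonormalFrame_frameOf`, `exists_mem_stiefelSet_frameOf_eq`). [folklore] -/
def stiefelSet : Set (Fin 4 → κ → ℝ) :=
  {A | ∀ a b : Fin 4, ∑ i, A a i * A b i = if a = b then 1 else 0}

/-- Membership in `stiefelSet`, unfolded. [folklore] -/
theorem mem_stiefelSet_iff {A : Fin 4 → κ → ℝ} :
    A ∈ stiefelSet κ ↔ ∀ a b : Fin 4, ∑ i, A a i * A b i = if a = b then 1 else 0 :=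
  Iff.rfl

/-- `stiefelSet` is closed (a level set of continuous functions). [folklore] -/
theorem isClosed_stiefelSet : IsClosed (stiefelSet κ) := by
  simp only [stiefelSet, setOf_forall]
  refine isClosed_iInter fun a ↦ isClosed_iInter fun b ↦ isClosed_eq ?_ continuous_const
  exact continuous_finsetSum _ fun i _ ↦
    (continuous_apply_apply a i).mul (continuous_apply_apply b i)

/-- Entries of an array with orthonormal rows are bounded by `1`. [folklore] -/
theorem norm_le_one_of_mem_stiefelSet {A : Fin 4 → κ → ℝ} (hA : A ∈ stiefelSet κ) : ‖A‖ ≤ 1 := by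
  refine (pi_norm_le_iff_of_nonneg zero_le_one).2 fun a ↦
    (pi_norm_le_iff_of_nonneg zero_le_one).2 fun i ↦ ?_
  have h1 : ∑ j, A a j * A a j = 1 := by simpa using (mem_stiefelSet_iff.1 hA) a a
  have h2 : A a i * A a i ≤ ∑ j, A a j * A a j :=
    Finset.single_le_sum (fun j _ ↦ mul_self_nonneg (A a j)) (Finset.mem_univ i)
  rw [Real.norm_eq_abs]
  exact abs_le_one_iff_mul_self_le_one.2 (h2.trans_eq h1)

/-- **`stiefelSet` is compact** (closed and bounded in a finite-dimensional space). [folklore] -/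
theorem isCompact_stiefelSet : IsCompact (stiefelSet κ) :=
  (isCompact_closedBall (0 : Fin 4 → κ → ℝ) 1).of_isClosed_subset isClosed_stiefelSet
    fun _ hA ↦ mem_closedBall_zero_iff.2 (norm_le_one_of_mem_stiefelSet hA)

/-- The `4`-frame with coefficient array `A` in the family `s`: `e_a = Σ_i A a i • s i`.
[folklore] -/
def frameOf {x : M} (s : κ → TangentSpace I x) (A : Fin 4 → κ → ℝ) : Fin 4 → TangentSpace I x :=
  fun a ↦ ∑ i, A a i • s i

/-- The isotropic curvature of the frame with coefficients `A`, as a polynomial in `A` and in the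
curvature components `R i j k l = Rm_x(s i, s j, s k, s l)` of the family `s`: the expansion of
`Rm(e₁,e₃,e₃,e₁) + Rm(e₁,e₄,e₄,e₁) + Rm(e₂,e₃,e₃,e₂) + Rm(e₂,e₄,e₄,e₂) - 2 Rm(e₁,e₂,e₄,e₃)`
(`isotropicCurvature`) by multilinearity (`isotropicCurvature_frameOf`). [folklore] -/
def isotropicCurvatureCoeff (R : κ → κ → κ → κ → ℝ) (A : Fin 4 → κ → ℝ) : ℝ :=
  (∑ i, ∑ j, ∑ k, ∑ l, A 0 i * A 2 j * A 2 k * A 0 l * R i j k l) +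
    (∑ i, ∑ j, ∑ k, ∑ l, A 0 i * A 3 j * A 3 k * A 0 l * R i j k l) +
    (∑ i, ∑ j, ∑ k, ∑ l, A 1 i * A 2 j * A 2 k * A 1 l * R i j k l) +
    (∑ i, ∑ j, ∑ k, ∑ l, A 1 i * A 3 j * A 3 k * A 1 l * R i j k l) -
    2 * ∑ i, ∑ j, ∑ k, ∑ l, A 0 i * A 1 j * A 3 k * A 2 l * R i j k l

/-- `isotropicCurvatureCoeff R A` is jointly continuous in `(R, A)` (a polynomial). [folklore] -/
theorem continuous_isotropicCurvatureCoeff :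
    Continuous fun p : (κ → κ → κ → κ → ℝ) × (Fin 4 → κ → ℝ) ↦
      isotropicCurvatureCoeff p.1 p.2 := by
  have hA : ∀ (a : Fin 4) (i : κ),
      Continuous fun p : (κ → κ → κ → κ → ℝ) × (Fin 4 → κ → ℝ) ↦ p.2 a i := fun a i ↦
    (continuous_apply i).comp ((continuous_apply a).comp continuous_snd)
  have hR : ∀ i j k l : κ,
      Continuous fun p : (κ → κ → κ → κ → ℝ) × (Fin 4 → κ → ℝ) ↦ p.1 i j k l := fun i j k l ↦
    (continuous_apply l).comp ((continuous_apply k).comp ((continuous_apply j).comp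
      ((continuous_apply i).comp continuous_fst)))
  have hterm : ∀ a b c d : Fin 4, Continuous fun p : (κ → κ → κ → κ → ℝ) × (Fin 4 → κ → ℝ) ↦
      ∑ i, ∑ j, ∑ k, ∑ l, p.2 a i * p.2 b j * p.2 c k * p.2 d l * p.1 i j k l := by
    intro a b c d
    refine continuous_finsetSum _ fun i _ ↦ continuous_finsetSum _ fun j _ ↦
      continuous_finsetSum _ fun k _ ↦ continuous_finsetSum _ fun l _ ↦ ?_
    exact ((((hA a i).mul (hA b j)).mul (hA c k)).mul (hA d l)).mul (hR i j k l)
  simp only [isotropicCurvatureCoeff]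
  exact ((((hterm 0 2 2 0).add (hterm 0 3 3 0)).add (hterm 1 2 2 1)).add (hterm 1 3 3 1)).sub
    (continuous_const.mul (hterm 0 1 3 2))

/-- For fixed curvature components `R`, `A ↦ isotropicCurvatureCoeff R A` is continuous.
[folklore] -/
theorem continuous_isotropicCurvatureCoeff_right (R : κ → κ → κ → κ → ℝ) :
    Continuous (isotropicCurvatureCoeff R) := by
  -- elaborate the composite first: unifying `?f ∘ ?g` against the polynomial unfolds it
  have h := (continuous_isotropicCurvatureCoeff (κ := κ)).comp (Continuous.prodMk_right R)
  exact h

variable (g : PseudoRiemannianMetric I n E (TangentSpace I : M → Type _))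
  (cov : CovariantDerivative I E (TangentSpace I : M → Type _))

/-- **The isotropic curvature of `e_a = Σ_i A a i • s i` is the polynomial
`isotropicCurvatureCoeff` of `A` and of the curvature components of `s`** (multilinearity of
`Rm`, `curvatureForm_sum_smul`). [folklore] -/
theorem isotropicCurvature_frameOf {x : M} (s : κ → TangentSpace I x) (A : Fin 4 → κ → ℝ) :
    g.isotropicCurvature cov x (frameOf s A) =
      isotropicCurvatureCoeff (fun i j k l ↦ g.curvatureForm cov x (s i) (s j) (s k) (s l)) A := by
  simp only [isotropicCurvature, frameOf, isotropicCurvatureCoeff, curvatureForm_sum_smul]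

variable {g}

/-- `g_x(Σ aᵢ sᵢ, Σ cⱼ sⱼ) = Σ aᵢ cᵢ` for a `g_x`-orthonormal family `s`. [folklore] -/
theorem val_sum_smul_sum_smul_of_isOrthonormalFrame {x : M} {s : κ → TangentSpace I x}
    (hs : g.IsOrthonormalFrame x s) (a c : κ → ℝ) :
    g.val x (∑ i, a i • s i) (∑ j, c j • s j) = ∑ i, a i * c i := by
  classical
  rw [val_sum_smul_sum_smul g]
  refine Finset.sum_congr rfl fun i _ ↦ ?_
  rw [Finset.sum_eq_single i]
  · rw [hs.1 i, mul_one]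
  · intro j _ hji
    rw [hs.2 i j (Ne.symm hji), mul_zero]
  · intro hi
    exact absurd (Finset.mem_univ i) hi

/-- An orthonormal family (for any pseudo-Riemannian metric) is linearly independent: pair a
vanishing combination with `s j`. [folklore] -/
theorem linearIndependent_of_isOrthonormalFrame {x : M} {s : κ → TangentSpace I x}
    (hs : g.IsOrthonormalFrame x s) : LinearIndependent ℝ s := by
  classical
  rw [Fintype.linearIndependent_iff]
  intro c hc j
  have h : g.val x (∑ i, c i • s i) (∑ i, (Pi.single j (1 : ℝ) : κ → ℝ) i • s i) = 0 := by
    rw [hc]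
    simp
  rw [val_sum_smul_sum_smul_of_isOrthonormalFrame hs] at h
  simpa [Pi.single_apply] using h

/-- In a `g_x`-orthonormal family `s`, every coefficient array with orthonormal rows gives a
`g_x`-orthonormal `4`-frame `frameOf s A`. [folklore] -/
theorem isOrthonormalFrame_frameOf {x : M} {s : κ → TangentSpace I x}
    (hs : g.IsOrthonormalFrame x s) {A : Fin 4 → κ → ℝ} (hA : A ∈ stiefelSet κ) :
    g.IsOrthonormalFrame x (frameOf s A) := by
  have hval : ∀ a b, g.val x (frameOf s A a) (frameOf s A b) = ∑ i, A a i * A b i :=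
    fun a b ↦ val_sum_smul_sum_smul_of_isOrthonormalFrame hs (A a) (A b)
  refine ⟨fun a ↦ ?_, fun a b hab ↦ ?_⟩
  · rw [hval, (mem_stiefelSet_iff.1 hA) a a, if_pos rfl]
  · rw [hval, (mem_stiefelSet_iff.1 hA) a b, if_neg hab]

/-- Conversely, in a `g_x`-orthonormal family `s` of size `dim M` (hence a basis of `T_x M`),
every `g_x`-orthonormal `4`-frame is `frameOf s A` for some `A ∈ stiefelSet` (its coordinate
array). [folklore] -/
theorem exists_mem_stiefelSet_frameOf_eq [FiniteDimensional ℝ E] {x : M}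
    {s : Fin (finrank ℝ E) → TangentSpace I x} (hs : g.IsOrthonormalFrame x s)
    {e : Fin 4 → TangentSpace I x} (he : g.IsOrthonormalFrame x e) :
    ∃ A ∈ stiefelSet (Fin (finrank ℝ E)), frameOf s A = e := by
  classical
  haveI : FiniteDimensional ℝ (TangentSpace I x) := ‹FiniteDimensional ℝ E›
  have hli := linearIndependent_of_isOrthonormalFrame hs
  have hcard : Fintype.card (Fin (finrank ℝ E)) = finrank ℝ (TangentSpace I x) :=
    Fintype.card_fin _
  let b : Basis (Fin (finrank ℝ E)) ℝ (TangentSpace I x) :=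
    basisOfLinearIndependentOfCardEqFinrank' s hli hcard
  have hb : ⇑b = s := coe_basisOfLinearIndependentOfCardEqFinrank' s hli hcard
  have hrepr : ∀ v : TangentSpace I x, ∑ i, b.repr v i • s i = v := fun v ↦ by
    conv_rhs => rw [← b.sum_repr v]
    rw [hb]
  refine ⟨fun a i ↦ b.repr (e a) i, mem_stiefelSet_iff.2 fun a c ↦ ?_, funext fun a ↦ hrepr (e a)⟩
  show ∑ i, b.repr (e a) i * b.repr (e c) i = _
  rw [← val_sum_smul_sum_smul_of_isOrthonormalFrame hs, hrepr, hrepr]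
  by_cases hac : a = c
  · subst hac
    rw [if_pos rfl, he.1 a]
  · rw [if_neg hac, he.2 a c hac]

/-- **Orthonormal frames at a point are parametrised by `stiefelSet`**: in a `g_x`-orthonormal
basis `s`, the set of isotropic curvatures of the `g_x`-orthonormal `4`-frames is the image of the
compact set `stiefelSet` under the polynomial `isotropicCurvatureCoeff`. [folklore] -/
theorem range_isotropicCurvature_eq_image [FiniteDimensional ℝ E] {x : M}
    {s : Fin (finrank ℝ E) → TangentSpace I x} (hs : g.IsOrthonormalFrame x s) :
    Set.range (fun e : {e : Fin 4 → TangentSpace I x // g.IsOrthonormalFrame x e} ↦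
        g.isotropicCurvature cov x e.1) =
      isotropicCurvatureCoeff (fun i j k l ↦ g.curvatureForm cov x (s i) (s j) (s k) (s l)) ''
        stiefelSet (Fin (finrank ℝ E)) := by
  ext r
  constructor
  · rintro ⟨⟨e, he⟩, rfl⟩
    obtain ⟨A, hA, hAe⟩ := exists_mem_stiefelSet_frameOf_eq hs he
    exact ⟨A, hA, by rw [← isotropicCurvature_frameOf g cov s A, hAe]⟩
  · rintro ⟨A, hA, rfl⟩
    exact ⟨⟨frameOf s A, isOrthonormalFrame_frameOf hs hA⟩, isotropicCurvature_frameOf g cov s A⟩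

end Coefficients

/-! ### The minimal isotropic curvature of a connection -/

section MinIsoWith

variable (g : PseudoRiemannianMetric I n E (TangentSpace I : M → Type _))
  (cov : CovariantDerivative I E (TangentSpace I : M → Type _))

/-- The **minimal isotropic curvature of the pair `(g, cov)`** at `x`: the infimum over the
`g_x`-orthonormal `4`-frames `e = (e₁, e₂, e₃, e₄)` of the isotropic curvature
`K(e₁,e₃) + K(e₁,e₄) + K(e₂,e₃) + K(e₂,e₄) - 2R₁₂₃₄` of `e` for the curvature of `cov`
(`isotropicCurvature`; Micallef–Moore 1988, §1), the connection being a parameter as in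
`HasPositiveIsotropicCurvatureWith`. For the Levi-Civita connection of a smooth metric on a
4-manifold this is the tree's `minIsotropicCurvature g x`
(`minIsotropicCurvature_eq_minIsotropicCurvatureWith`). For Riemannian `g` it is a lower bound of
the isotropic curvatures, attained at some frame (`minIsotropicCurvatureWith_le`,
`exists_isotropicCurvature_eq_minIsotropicCurvatureWith`); junk value `sInf ∅ = 0` if `x`
carries no orthonormal `4`-frame. [cite: MicallefMoore1988, §1] -/
def minIsotropicCurvatureWith (x : M) : ℝ :=
  ⨅ e : {e : Fin 4 → TangentSpace I x // g.IsOrthonormalFrame x e}, g.isotropicCurvature cov x e.1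

variable {g}

/-- In a `g_x`-orthonormal basis the minimal isotropic curvature is the infimum of the polynomial
`isotropicCurvatureCoeff` over the compact set `stiefelSet`. [folklore] -/
theorem minIsotropicCurvatureWith_eq_sInf_image [FiniteDimensional ℝ E] {x : M}
    {s : Fin (finrank ℝ E) → TangentSpace I x} (hs : g.IsOrthonormalFrame x s) :
    minIsotropicCurvatureWith g cov x =
      sInf (isotropicCurvatureCoeff (fun i j k l ↦ g.curvatureForm cov x (s i) (s j) (s k) (s l)) ''
        stiefelSet (Fin (finrank ℝ E))) := by
  rw [minIsotropicCurvatureWith, iInf, range_isotropicCurvature_eq_image cov hs]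

/-- A `g_x`-orthonormal frame of a Riemannian `PseudoRiemannianMetric`, in the sense of Mathlib's
`Orthonormal` for the inner products `g.riemannianBundle hg`, is a `g.IsOrthonormalFrame`.
[folklore] -/
theorem isOrthonormalFrame_of_orthonormal [FiniteDimensional ℝ E] (hg : g.IsRiemannian) {x : M}
    {ι : Type*} {e : ι → TangentSpace I x}
    (he : letI := g.riemannianBundle hg; Orthonormal ℝ e) : g.IsOrthonormalFrame x e := by
  classical
  letI := g.riemannianBundle hg
  rw [orthonormal_iff_ite] at he
  refine ⟨fun i ↦ ?_, fun i j hij ↦ ?_⟩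
  · have h := he i i
    rw [if_pos rfl] at h
    exact h
  · have h := he i j
    rw [if_neg hij] at h
    exact h

/-- **A Riemannian metric has an orthonormal basis at every point** (`dim M` orthonormal tangent
vectors; Gram–Schmidt, here through `Literature.Geometry.Kaehler.orthoFrame`). [folklore] -/
theorem exists_isOrthonormalFrame_finrank [FiniteDimensional ℝ E] (hg : g.IsRiemannian) (x : M) :
    ∃ s : Fin (finrank ℝ E) → TangentSpace I x, g.IsOrthonormalFrame x s := by
  letI := g.riemannianBundle hg
  haveI : Fact (finrank ℝ E = finrank ℝ E) := ⟨rfl⟩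
  exact ⟨fun i ↦ Kaehler.orthoFrame I (finrank ℝ E) x i x,
    isOrthonormalFrame_of_orthonormal hg
      (Kaehler.orthonormal_orthoFrame (I := I) (n := finrank ℝ E) (mem_chart_source H x))⟩

/-- On a Riemannian manifold of dimension `≥ 4` every point carries a `g_x`-orthonormal `4`-frame.
[folklore] -/
theorem exists_isOrthonormalFrame_four [FiniteDimensional ℝ E] (hg : g.IsRiemannian)
    (h4 : 4 ≤ finrank ℝ E) (x : M) :
    ∃ e : Fin 4 → TangentSpace I x, g.IsOrthonormalFrame x e := by
  obtain ⟨s, hs⟩ := exists_isOrthonormalFrame_finrank hg x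
  exact ⟨s ∘ Fin.castLE h4, hs.comp (Fin.castLE_injective h4)⟩

/-- For a Riemannian metric the isotropic curvatures of the orthonormal `4`-frames at a point form
a bounded-below set (a continuous image of the compact `stiefelSet`). [folklore] -/
theorem bddBelow_range_isotropicCurvature [FiniteDimensional ℝ E] (hg : g.IsRiemannian) (x : M) :
    BddBelow (Set.range fun e : {e : Fin 4 → TangentSpace I x // g.IsOrthonormalFrame x e} ↦
      g.isotropicCurvature cov x e.1) := by
  obtain ⟨s, hs⟩ := exists_isOrthonormalFrame_finrank hg x
  rw [range_isotropicCurvature_eq_image cov hs]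
  exact isCompact_stiefelSet.bddBelow_image
    (continuous_isotropicCurvatureCoeff_right _).continuousOn

/-- **The minimal isotropic curvature is a lower bound**: for a Riemannian metric,
`minIsotropicCurvatureWith g cov x ≤ iso_x(e)` for every `g_x`-orthonormal `4`-frame `e`.
[cite: MicallefMoore1988, §1] -/
theorem minIsotropicCurvatureWith_le [FiniteDimensional ℝ E] (hg : g.IsRiemannian) {x : M}
    {e : Fin 4 → TangentSpace I x} (he : g.IsOrthonormalFrame x e) :
    minIsotropicCurvatureWith g cov x ≤ g.isotropicCurvature cov x e :=
  ciInf_le (bddBelow_range_isotropicCurvature cov hg x) ⟨e, he⟩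

/-- Any lower bound of the isotropic curvatures at `x` is at most the minimal isotropic curvature,
provided `x` carries an orthonormal `4`-frame. [folklore] -/
theorem le_minIsotropicCurvatureWith {x : M}
    (hx : ∃ e : Fin 4 → TangentSpace I x, g.IsOrthonormalFrame x e)
    {m : ℝ} (hm : ∀ e : Fin 4 → TangentSpace I x, g.IsOrthonormalFrame x e →
      m ≤ g.isotropicCurvature cov x e) :
    m ≤ minIsotropicCurvatureWith g cov x := by
  obtain ⟨e₀, he₀⟩ := hx
  haveI : Nonempty {e : Fin 4 → TangentSpace I x // g.IsOrthonormalFrame x e} := ⟨⟨e₀, he₀⟩⟩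
  exact le_ciInf fun e ↦ hm e.1 e.2

/-- **The minimal isotropic curvature is attained**: for a Riemannian metric and a point carrying
an orthonormal `4`-frame there is a `g_x`-orthonormal `4`-frame `e` with
`iso_x(e) = minIsotropicCurvatureWith g cov x` (minimum of a continuous function on the compact
set of orthonormal frames). [folklore] -/
theorem exists_isotropicCurvature_eq_minIsotropicCurvatureWith [FiniteDimensional ℝ E]
    (hg : g.IsRiemannian) {x : M} (hx : ∃ e : Fin 4 → TangentSpace I x, g.IsOrthonormalFrame x e) :
    ∃ e : Fin 4 → TangentSpace I x, g.IsOrthonormalFrame x e ∧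
      g.isotropicCurvature cov x e = minIsotropicCurvatureWith g cov x := by
  obtain ⟨s, hs⟩ := exists_isOrthonormalFrame_finrank hg x
  obtain ⟨e₀, he₀⟩ := hx
  have hne : (isotropicCurvatureCoeff
      (fun i j k l ↦ g.curvatureForm cov x (s i) (s j) (s k) (s l)) ''
        stiefelSet (Fin (finrank ℝ E))).Nonempty := by
    rw [← range_isotropicCurvature_eq_image cov hs]
    exact ⟨_, ⟨e₀, he₀⟩, rfl⟩
  have hmem :=
    (isCompact_stiefelSet.image (continuous_isotropicCurvatureCoeff_right _)).sInf_mem hne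
  rw [← minIsotropicCurvatureWith_eq_sInf_image cov hs,
    ← range_isotropicCurvature_eq_image cov hs] at hmem
  obtain ⟨⟨e, he⟩, h⟩ := hmem
  exact ⟨e, he, h⟩

/-- Positive isotropic curvature of `(g, cov)` gives a positive minimal isotropic curvature at
every point carrying an orthonormal `4`-frame (the minimum is attained).
[cite: MicallefMoore1988, §1] -/
theorem minIsotropicCurvatureWith_pos [FiniteDimensional ℝ E] (hg : g.IsRiemannian)
    (h : g.HasPositiveIsotropicCurvatureWith cov) {x : M}
    (hx : ∃ e : Fin 4 → TangentSpace I x, g.IsOrthonormalFrame x e) :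
    0 < minIsotropicCurvatureWith g cov x := by
  obtain ⟨e, he, heq⟩ := exists_isotropicCurvature_eq_minIsotropicCurvatureWith cov hg hx
  rw [← heq]
  exact h x e he

/-- **Continuity of the minimal isotropic curvature.** For a `C^∞` Riemannian metric `g` and a
Levi-Civita connection `cov` of `g`, `x ↦ minIsotropicCurvatureWith g cov x` is continuous: near
`x₀` choose a smooth orthonormal frame field `s` (Gram–Schmidt on a coordinate frame,
`Literature.Geometry.Kaehler.orthoFrame`; Warner GTM 94, 4.10); the orthonormal `4`-frames at `x`
are then the `frameOf (s · x) A`, `A ∈ stiefelSet` — a compact parameter set independent of `x` —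
and the isotropic curvature is the polynomial `isotropicCurvatureCoeff` in `A` with coefficients
the curvature components `Rm_x(sᵢ, sⱼ, sₖ, sₗ)`, continuous in `x` (`contMDiffOn_curvature_apply`;
O'Neill 1983, Lemma 3.35: `R` is a tensor field); the infimum over a fixed compact set of a jointly
continuous function is continuous (`IsCompact.continuous_sInf`). [folklore] -/
theorem continuous_minIsotropicCurvatureWith [FiniteDimensional ℝ E] [CompleteSpace E]
    {g : PseudoRiemannianMetric I ∞ E (TangentSpace I : M → Type _)} (hg : g.IsRiemannian)
    {cov : CovariantDerivative I E (TangentSpace I : M → Type _)} (hcov : g.IsLeviCivita cov) :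
    Continuous (minIsotropicCurvatureWith g cov) := by
  classical
  letI := g.riemannianBundle hg
  haveI : Fact (finrank ℝ E = finrank ℝ E) := ⟨rfl⟩
  refine continuous_iff_continuousAt.2 fun x₀ ↦ ?_
  -- the chart domain at `x₀` and the smooth orthonormal frame field on it
  set U : Set M := (chartAt H x₀).source with hUdef
  have hU : IsOpen U := (chartAt H x₀).open_source
  have hx₀ : x₀ ∈ U := mem_chart_source H x₀
  set s : Fin (finrank ℝ E) → Π x : M, TangentSpace I x := Kaehler.orthoFrame I (finrank ℝ E) x₀
    with hsdef
  have hsON : ∀ x ∈ U, g.IsOrthonormalFrame x (fun i ↦ s i x) := fun x hx ↦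
    isOrthonormalFrame_of_orthonormal hg
      (Kaehler.orthonormal_orthoFrame (I := I) (n := finrank ℝ E) hx)
  have hsC : ∀ i, ContMDiffOn I (I.prod 𝓘(ℝ, E)) ∞ (fun y ↦ TotalSpace.mk' E y (s i y)) U :=
    fun i x hx ↦ (Kaehler.contMDiffAt_orthoFrame hx i).contMDiffWithinAt
  -- continuity of the curvature components in the frame field
  have hR : ∀ i j k l, ContinuousOn
      (fun x ↦ g.curvatureForm cov x (s i x) (s j x) (s k x) (s l x)) U := by
    intro i j k l
    have h1 : cov.IsLocallyContMDiff 1 :=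
      hcov.isLocallyContMDiff_one (WithTop.coe_le_coe.mpr le_top)
    have hinf : cov.IsLocallyContMDiff (⊤ : ℕ∞) := hcov.isLocallyContMDiff ⊤ (le_of_eq rfl)
    have hRs := contMDiffOn_curvature_apply h1 hinf hU (hsC i) (hsC j) (hsC k)
    intro y hy
    have hRy := (hRs y hy).contMDiffAt (hU.mem_nhds hy)
    have hly := (hsC l y hy).contMDiffAt (hU.mem_nhds hy)
    exact (g.contMDiffAt_val_apply le_rfl hRy hly).continuousAt.continuousWithinAt
  -- the curvature components and the functional on the subtype `U`
  set Rc : U →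
      (Fin (finrank ℝ E) → Fin (finrank ℝ E) → Fin (finrank ℝ E) → Fin (finrank ℝ E) → ℝ) :=
    fun x i j k l ↦ g.curvatureForm cov x.1 (s i x.1) (s j x.1) (s k x.1) (s l x.1) with hRc
  have hRcc : Continuous Rc :=
    continuous_pi fun i ↦ continuous_pi fun j ↦ continuous_pi fun k ↦ continuous_pi fun l ↦
      continuousOn_iff_continuous_restrict.1 (hR i j k l)
  set f : U → (Fin 4 → Fin (finrank ℝ E) → ℝ) → ℝ := fun x A ↦ isotropicCurvatureCoeff (Rc x) A
    with hf
  have hfc : Continuous ↿f := by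
    have h := (continuous_isotropicCurvatureCoeff (κ := Fin (finrank ℝ E))).comp
      (hRcc.prodMap continuous_id)
    exact h
  have hcont : Continuous fun x : U ↦ sInf (f x '' stiefelSet (Fin (finrank ℝ E))) :=
    isCompact_stiefelSet.continuous_sInf hfc
  have heq : ∀ x : U,
      minIsotropicCurvatureWith g cov x = sInf (f x '' stiefelSet (Fin (finrank ℝ E))) :=
    fun x ↦ minIsotropicCurvatureWith_eq_sInf_image cov (hsON x x.2)
  have hcontU : ContinuousOn (minIsotropicCurvatureWith g cov) U := by
    rw [continuousOn_iff_continuous_restrict]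
    have : U.restrict (minIsotropicCurvatureWith g cov) =
        fun x : U ↦ sInf (f x '' stiefelSet (Fin (finrank ℝ E))) := funext fun x ↦ heq x
    rw [this]
    exact hcont
  exact hcontU.continuousAt (hU.mem_nhds hx₀)

/-- Continuity of the minimal isotropic curvature of the Levi-Civita connection `g.leviCivita` of
a `C^∞` Riemannian metric on any model (a Levi-Civita connection by the fundamental lemma,
`isLeviCivita_leviCivita_holds`). [folklore] -/
theorem continuous_minIsotropicCurvatureWith_leviCivita [FiniteDimensional ℝ E] [CompleteSpace E]
    {g : PseudoRiemannianMetric I ∞ E (TangentSpace I : M → Type _)} (hg : g.IsRiemannian)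
    [g.HasLeviCivita] : Continuous (minIsotropicCurvatureWith g g.leviCivita) :=
  continuous_minIsotropicCurvatureWith hg (isLeviCivita_leviCivita_holds (g := g))

end MinIsoWith

/-! ### The minimal isotropic curvature of a Riemannian 4-manifold -/

section Four

variable {P : Type*} [TopologicalSpace P] [ChartedSpace (EuclideanSpace ℝ (Fin 4)) P]
  [IsManifold (𝓡 4) ∞ P]
  (G : PseudoRiemannianMetric (𝓡 4) ∞ (EuclideanSpace ℝ (Fin 4)) (TangentSpace (𝓡 4) : P → Type _))
  [G.HasLeviCivita]

/-- The tree's `minIsotropicCurvature G x` (4-manifolds, Levi-Civita connection;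
`ChenZhuConformalPIC.lean`) is `minIsotropicCurvatureWith G G.leviCivita x`, by definition.
[folklore] -/
theorem minIsotropicCurvature_eq_minIsotropicCurvatureWith (x : P) :
    minIsotropicCurvature G x = minIsotropicCurvatureWith G G.leviCivita x :=
  rfl

variable {G}

omit [G.HasLeviCivita] in
/-- Every point of a Riemannian 4-manifold carries a `G_x`-orthonormal `4`-frame. [folklore] -/
theorem exists_isOrthonormalFrame (hG : G.IsRiemannian) (x : P) :
    ∃ e : Fin 4 → TangentSpace (𝓡 4) x, G.IsOrthonormalFrame x e :=
  exists_isOrthonormalFrame_four hG (by simp) x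

/-- **`minIsotropicCurvature G x ≤ iso_x(e)`** for every `G_x`-orthonormal `4`-frame `e` of a
Riemannian 4-manifold. [cite: MicallefMoore1988, §1] -/
theorem minIsotropicCurvature_le (hG : G.IsRiemannian) {x : P} {e : Fin 4 → TangentSpace (𝓡 4) x}
    (he : G.IsOrthonormalFrame x e) :
    minIsotropicCurvature G x ≤ G.isotropicCurvature G.leviCivita x e :=
  minIsotropicCurvatureWith_le G.leviCivita hG he

/-- A lower bound of the isotropic curvatures at `x` is at most `minIsotropicCurvature G x`
(Riemannian 4-manifold). [folklore] -/
theorem le_minIsotropicCurvature (hG : G.IsRiemannian) {x : P} {m : ℝ}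
    (hm : ∀ e : Fin 4 → TangentSpace (𝓡 4) x, G.IsOrthonormalFrame x e →
      m ≤ G.isotropicCurvature G.leviCivita x e) :
    m ≤ minIsotropicCurvature G x :=
  le_minIsotropicCurvatureWith G.leviCivita (exists_isOrthonormalFrame hG x) hm

/-- **The minimal isotropic curvature of a Riemannian 4-manifold is attained** at some orthonormal
`4`-frame. [folklore] -/
theorem exists_isotropicCurvature_eq_minIsotropicCurvature (hG : G.IsRiemannian) (x : P) :
    ∃ e : Fin 4 → TangentSpace (𝓡 4) x, G.IsOrthonormalFrame x e ∧
      G.isotropicCurvature G.leviCivita x e = minIsotropicCurvature G x :=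
  exists_isotropicCurvature_eq_minIsotropicCurvatureWith G.leviCivita hG
    (exists_isOrthonormalFrame hG x)

/-- On a Riemannian 4-manifold of positive isotropic curvature the minimal isotropic curvature is
positive everywhere (`σ_G > 0`; Chen–Zhu 2014, §3). [cite: ChenZhu2014, §3] -/
theorem minIsotropicCurvature_pos (hG : G.IsRiemannian) (h : G.HasPositiveIsotropicCurvature)
    (x : P) : 0 < minIsotropicCurvature G x :=
  minIsotropicCurvatureWith_pos G.leviCivita hG (h.with G.isLeviCivita_leviCivita_holds)
    (exists_isOrthonormalFrame hG x)

/-- **The minimal isotropic curvature of a smooth Riemannian 4-manifold is continuous**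
(`continuous_minIsotropicCurvatureWith`). [folklore] -/
theorem continuous_minIsotropicCurvature (hG : G.IsRiemannian) :
    Continuous (minIsotropicCurvature G) := by
  have h : minIsotropicCurvature G = minIsotropicCurvatureWith G G.leviCivita := rfl
  rw [h]
  exact continuous_minIsotropicCurvatureWith_leviCivita hG

end Four

/-! ### Neumann positivity of the isotropic Yamabe form -/

section Neumann

variable [FiniteDimensional ℝ E] [T3Space M] [MeasurableSpace M] [BorelSpace M]

/-- **Neumann positivity of the isotropic Yamabe form of `g` on `S ⊆ M`.** For a Riemannian
metric `g` (`hg`) with its Levi-Civita connection (`[g.HasLeviCivita]`) and a subset `S`: there are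
a constant `c > 0` and a continuous lower bound `μ : M → ℝ` of the isotropic curvatures of `g`
(`μ x ≤ iso_x(e)` for every `g_x`-orthonormal `4`-frame `e`, i.e. `μ ≤ minIsotropicCurvature g`)
such that for every `u ∈ C¹(M)`
`c ∫_S u² dV_g ≤ ∫_S (6 |∇u|²_g + 3 μ u²) dV_g`,
with `dV_g = riemannianMeasure (g.toContMDiffRiemannianMetric hg)` and `|∇u|²_g = g.gradSq u`.
This is positivity of the quadratic form of Chen–Zhu's conformal operator `-6Δ_g + σ_g`,
`σ_g = R_g - 6 max(λ_max W⁺, λ_max W⁻) = 3 ·` minimal isotropic curvature (Chen–Zhu 2014, (2.8)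
with `n = 4` and §3), restricted to `S` with no boundary condition on `u` (the Neumann form, as in
Dirichlet–Neumann bracketing, Reed–Simon IV §XIII.15); for `S = univ` see
`neumannIsotropicFormPos_univ_iff`, and for the equivalent form with `μ` the minimal isotropic
curvature see `neumannIsotropicFormPos_iff_minIsotropicCurvature`. The coefficients are those of
dimension `4`. A *definition* (predicate on `(g, S)`), the clause inlined by the items of route
`SmoothPoincare4/IsotropicCorkBracketing`; it fails e.g. for flat metrics and `S` of positive
measure (`u ≡ 1`). [cite: ChenZhu2014, §2 (2.8) and §3] -/
def NeumannIsotropicFormPos (g : PseudoRiemannianMetric I n E (TangentSpace I : M → Type _))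
    (hg : g.IsRiemannian) [g.HasLeviCivita] (S : Set M) : Prop :=
  ∃ c : ℝ, 0 < c ∧ ∃ μ : M → ℝ, Continuous μ ∧
    (∀ (x : M) (e : Fin 4 → TangentSpace I x), g.IsOrthonormalFrame x e →
      μ x ≤ g.isotropicCurvature g.leviCivita x e) ∧
    ∀ u : M → ℝ, ContMDiff I 𝓘(ℝ, ℝ) 1 u →
      c * ∫ x in S, u x ^ 2 ∂riemannianMeasure (g.toContMDiffRiemannianMetric hg) ≤
        ∫ x in S, (6 * g.gradSq u x + 3 * μ x * u x ^ 2)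
          ∂riemannianMeasure (g.toContMDiffRiemannianMetric hg)

variable (g : PseudoRiemannianMetric I n E (TangentSpace I : M → Type _))

/-- The Riemannian measure of a compact manifold is finite
(`riemannianVolume_lt_top_of_isCompact_holds`). [folklore] -/
theorem isFiniteMeasure_riemannianMeasure_of_compactSpace [CompactSpace M] (hg : g.IsRiemannian) :
    IsFiniteMeasure (riemannianMeasure (g.toContMDiffRiemannianMetric hg)) :=
  ⟨riemannianVolume_lt_top_of_isCompact_holds (g.toContMDiffRiemannianMetric hg) le_rfl
    isCompact_univ⟩

variable [g.HasLeviCivita]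

/-- Unfolding `NeumannIsotropicFormPos`. [folklore] -/
theorem neumannIsotropicFormPos_iff (hg : g.IsRiemannian) (S : Set M) :
    NeumannIsotropicFormPos g hg S ↔
      ∃ c : ℝ, 0 < c ∧ ∃ μ : M → ℝ, Continuous μ ∧
        (∀ (x : M) (e : Fin 4 → TangentSpace I x), g.IsOrthonormalFrame x e →
          μ x ≤ g.isotropicCurvature g.leviCivita x e) ∧
        ∀ u : M → ℝ, ContMDiff I 𝓘(ℝ, ℝ) 1 u →
          c * ∫ x in S, u x ^ 2 ∂riemannianMeasure (g.toContMDiffRiemannianMetric hg) ≤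
            ∫ x in S, (6 * g.gradSq u x + 3 * μ x * u x ^ 2)
              ∂riemannianMeasure (g.toContMDiffRiemannianMetric hg) :=
  Iff.rfl

/-- **The whole-manifold form**: `NeumannIsotropicFormPos g hg univ` is positive definiteness of
the isotropic Yamabe form on `C¹(M)`, `c ∫_M u² ≤ ∫_M (6|∇u|² + 3μu²)` — verbatim the clause of
the target item of route `SmoothPoincare4/IsotropicCorkBracketing` and the hypothesis of
`chenZhu_conformalPic_of_isotropicFormPos` (`ChenZhuConformalPic.lean`).
[cite: ChenZhu2014, §2 (2.8) and §3] -/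
theorem neumannIsotropicFormPos_univ_iff (hg : g.IsRiemannian) :
    NeumannIsotropicFormPos g hg univ ↔
      ∃ c : ℝ, 0 < c ∧ ∃ μ : M → ℝ, Continuous μ ∧
        (∀ (x : M) (e : Fin 4 → TangentSpace I x), g.IsOrthonormalFrame x e →
          μ x ≤ g.isotropicCurvature g.leviCivita x e) ∧
        ∀ u : M → ℝ, ContMDiff I 𝓘(ℝ, ℝ) 1 u →
          c * ∫ x, u x ^ 2 ∂riemannianMeasure (g.toContMDiffRiemannianMetric hg) ≤
            ∫ x, (6 * g.gradSq u x + 3 * μ x * u x ^ 2)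
              ∂riemannianMeasure (g.toContMDiffRiemannianMetric hg) := by
  simp only [NeumannIsotropicFormPos, Measure.restrict_univ]

end Neumann

/-! ### The witness `μ = minIsotropicCurvature` on closed 4-manifolds -/

section NeumannFour

variable {P : Type*} [TopologicalSpace P] [ChartedSpace (EuclideanSpace ℝ (Fin 4)) P]
  [IsManifold (𝓡 4) ∞ P] [T3Space P] [MeasurableSpace P] [BorelSpace P]
  {G : PseudoRiemannianMetric (𝓡 4) ∞ (EuclideanSpace ℝ (Fin 4)) (TangentSpace (𝓡 4) : P → Type _)}
  [G.HasLeviCivita]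

/-- **Sufficiency of the minimal isotropic curvature**: on a smooth Riemannian 4-manifold, a
constant `c > 0` with `c ∫_S u² ≤ ∫_S (6|∇u|² + 3 · minIsotropicCurvature G · u²)` for all
`u ∈ C¹(P)` gives `NeumannIsotropicFormPos G hG S` (with `μ` the minimal isotropic curvature,
continuous by `continuous_minIsotropicCurvature`, a lower bound by `minIsotropicCurvature_le`).
[folklore] -/
theorem NeumannIsotropicFormPos.of_minIsotropicCurvature (hG : G.IsRiemannian) {S : Set P} {c : ℝ}
    (hc : 0 < c)
    (h : ∀ u : P → ℝ, ContMDiff (𝓡 4) 𝓘(ℝ, ℝ) 1 u →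
      c * ∫ x in S, u x ^ 2 ∂riemannianMeasure (G.toContMDiffRiemannianMetric hG) ≤
        ∫ x in S, (6 * G.gradSq u x + 3 * minIsotropicCurvature G x * u x ^ 2)
          ∂riemannianMeasure (G.toContMDiffRiemannianMetric hG)) :
    NeumannIsotropicFormPos G hG S :=
  ⟨c, hc, minIsotropicCurvature G, continuous_minIsotropicCurvature hG,
    fun _ _ he ↦ minIsotropicCurvature_le hG he, h⟩

/-- **Necessity of the minimal isotropic curvature**: on a closed smooth Riemannian 4-manifold,
`NeumannIsotropicFormPos G hG S` implies the inequality with `μ` replaced by the minimal isotropic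
curvature and the same constant: `μ ≤ minIsotropicCurvature G` pointwise
(`le_minIsotropicCurvature`) and both integrands are continuous (`continuous_innerDual_mvfderiv`
for `|∇u|²`, `continuous_minIsotropicCurvature`), hence integrable for the finite Riemannian
measure, so the integrals over `S` compare (`setIntegral_mono`). [folklore] -/
theorem NeumannIsotropicFormPos.exists_minIsotropicCurvature [CompactSpace P] {hG : G.IsRiemannian}
    {S : Set P} (h : NeumannIsotropicFormPos G hG S) :
    ∃ c : ℝ, 0 < c ∧ ∀ u : P → ℝ, ContMDiff (𝓡 4) 𝓘(ℝ, ℝ) 1 u →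
      c * ∫ x in S, u x ^ 2 ∂riemannianMeasure (G.toContMDiffRiemannianMetric hG) ≤
        ∫ x in S, (6 * G.gradSq u x + 3 * minIsotropicCurvature G x * u x ^ 2)
          ∂riemannianMeasure (G.toContMDiffRiemannianMetric hG) := by
  obtain ⟨c, hc, μ, hμc, hμle, hQ⟩ := h
  haveI := isFiniteMeasure_riemannianMeasure_of_compactSpace G hG
  refine ⟨c, hc, fun u hu ↦ (hQ u hu).trans ?_⟩
  have hmin : Continuous (minIsotropicCurvature G) := continuous_minIsotropicCurvature hG
  have huc : Continuous u := hu.continuous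
  have hgrad : Continuous (G.gradSq u) := continuous_innerDual_mvfderiv G hu hu
  have hint : ∀ {F : P → ℝ}, Continuous F →
      Integrable F (riemannianMeasure (G.toContMDiffRiemannianMetric hG)) := fun hF ↦
    integrableOn_univ.1 (hF.continuousOn.integrableOn_compact' isCompact_univ MeasurableSet.univ)
  refine setIntegral_mono (hint (by fun_prop)).integrableOn (hint (by fun_prop)).integrableOn
    fun x ↦ ?_
  have hμx : μ x ≤ minIsotropicCurvature G x := le_minIsotropicCurvature hG (hμle x)
  have hu2 : 0 ≤ u x ^ 2 := sq_nonneg _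
  nlinarith

/-- **`NeumannIsotropicFormPos` with `μ` the minimal isotropic curvature.** On a closed smooth
Riemannian 4-manifold, Neumann positivity of the isotropic Yamabe form on `S` (the `∃ μ` form of
the route items) is equivalent to the existence of `c > 0` with
`c ∫_S u² dV_G ≤ ∫_S (6|∇u|²_G + 3 · minIsotropicCurvature G · u²) dV_G` for all `u ∈ C¹(P)` —
Chen–Zhu's form `∫ 6|∇u|² + σ_G u²` ((2.8), §3), the shape of the hypothesis of
`chenZhu2014_conformal_pic_four`. [cite: ChenZhu2014, §2 (2.8) and §3] -/
theorem neumannIsotropicFormPos_iff_minIsotropicCurvature [CompactSpace P] (hG : G.IsRiemannian)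
    (S : Set P) :
    NeumannIsotropicFormPos G hG S ↔
      ∃ c : ℝ, 0 < c ∧ ∀ u : P → ℝ, ContMDiff (𝓡 4) 𝓘(ℝ, ℝ) 1 u →
        c * ∫ x in S, u x ^ 2 ∂riemannianMeasure (G.toContMDiffRiemannianMetric hG) ≤
          ∫ x in S, (6 * G.gradSq u x + 3 * minIsotropicCurvature G x * u x ^ 2)
            ∂riemannianMeasure (G.toContMDiffRiemannianMetric hG) :=
  ⟨fun h ↦ h.exists_minIsotropicCurvature,
    fun ⟨_, hc, h⟩ ↦ NeumannIsotropicFormPos.of_minIsotropicCurvature hG hc h⟩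

/-- Degenerate case: on the empty set the form is Neumann-positive for every smooth Riemannian
metric on a 4-manifold (both integrals vanish; the curvature clause is witnessed by the minimal
isotropic curvature) — a non-vacuity check of the curvature clause of the definition.
[folklore] -/
theorem neumannIsotropicFormPos_empty (hG : G.IsRiemannian) : NeumannIsotropicFormPos G hG ∅ :=
  NeumannIsotropicFormPos.of_minIsotropicCurvature hG one_pos fun u _ ↦ by
    simp only [Measure.restrict_empty, integral_zero_measure, mul_zero, le_refl]

end NeumannFour

end Literature.Geometry.Riemannian

end
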